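import Mathlib.FieldTheory.PrimitiveElement
import Mathlib.FieldTheory.Perfect
import Mathlib.RingTheory.Algebraic.Integral
import Mathlib.FieldTheory.Minpoly.IsIntegrallyClosed
import Mathlib.RingTheory.Localization.Integral
import Mathlib.RingTheory.Polynomial.UniqueFactorization
import Mathlib.RingTheory.Polynomial.RationalRoot
import Literature.NumberTheory.Transcendental.ExpVarietiesDimension
import Literature.NumberTheory.Transcendental.HypersurfaceCover
import Literature.RingTheory.KrullDimension.AffineDimension
import HarnessLib

/-!
# The hypersurface model of a variety with dominant additive projection

Algebraic input for the proof of `Literature.NumberTheory.Transcendental.BrownawellMasser2017_dominantProjection`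
(`ExpDominantSolvabilityProofs.lean`): the reduction of an irreducible `W ⊆ ℂⁿ × ℂⁿ` of
dimension `n` with dominant projection to the `x`-space to a hypersurface `F(x, T) = 0`,
`F ∈ ℂ[x][T]` monic, by a primitive element of `ℂ(W) / ℂ(x)` — the form in which
D'Aquino–Fornasiero–Terzo (*Generic solutions of equations with iterated exponentials*, Trans.
AMS 370 (2018), §2, Cor. 2.9 and Lemma 2.10: "there exist polynomials `p₁, …, pₙ ∈ ℂ[x̄, u]` and
`V` irreducible component … with `V ∩ W` Zariski dense in `V`") choose algebraic functions on one
sheet of the variety, made explicit as in Shafarevich's Lemma of *Basic Algebraic Geometry 2*,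
VII §2.3 (tree: `ZeroLocusConnectedProofs.exists_primitive`, `exists_separable`, there for a
finite projection; here the projection is only generically finite, so denominators appear).

* `Literature.NumberTheory.Transcendental.ExpDominant.eval₂_clearedPoly` — the bookkeeping identity behind clearing denominators in
  `f(x, N(x, T)/c(x))`.
* `Literature.NumberTheory.Transcendental.ExpDominant.exists_model` — for a prime `P ⊆ ℂ[x, y]` with `dim ℂ[x, y]/P = n`,
  `P ∩ ℂ[x] = 0` and `yⱼ ∉ P`: a monic `F ∈ ℂ[x][T]` of positive degree, `g ∈ ℂ[x] ∖ 0`,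
  `N ∈ ℂ[x][T]ⁿ`, `c ∈ ℂ[x]` and relations `pⱼ ∈ ℂ[x][u]` with `pⱼ(x, 0) ≠ 0`, such that off
  `g = 0` the specialisations `F(z, ·)` are separable, `c(z) ≠ 0`, every root `t` of `F(z, ·)`
  gives a point `(z, N(z, t)/c(z)) ∈ Z(P)`, and `pⱼ(x, yⱼ) = 0` on `Z(P)`.

## References

* P. D'Aquino, A. Fornasiero, G. Terzo, Trans. Amer. Math. Soc. 370 (2018), §2, Cor. 2.9,
  Lemma 2.10.
* I. R. Shafarevich, *Basic Algebraic Geometry 2*, Springer 1994, Book 3, Ch. VII §2.3, Lemma.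
-/

noncomputable section

open MvPolynomial

namespace Literature.NumberTheory.Transcendental.ExpDominant

open HypersurfaceCover (spec)

variable {n : ℕ}


/-- **Clearing denominators in `f(x, N(x, T)/c(x))`.** For `f ∈ ℂ[x, y]`, `N ∈ ℂ[x][T]ⁿ`,
`c ∈ ℂ[x]` and `e ≥ deg_y f`, the polynomial
`f^♮ = Σ_m f_m x^{m_x} N^{m_y} c^{e - |m_y|} ∈ ℂ[x][T]` evaluates, under any `ψ : ℂ[x] → S`,
`T ↦ s` with `N_j(s) = ψ(c) yⱼ`, to `ψ(c)^e · f(ψ(x), y)`. [folklore] -/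
theorem eval₂_clearedPoly (f : MvPolynomial (Fin n ⊕ Fin n) ℂ)
    (N : Fin n → Polynomial (MvPolynomial (Fin n) ℂ)) (c : MvPolynomial (Fin n) ℂ)
    (e : ℕ) (he : ∀ m ∈ f.support, ∑ j, m (Sum.inr j) ≤ e)
    {S : Type*} [CommRing S] (ψ : MvPolynomial (Fin n) ℂ →+* S) (s : S) (y : Fin n → S)
    (hy : ∀ j, (N j).eval₂ ψ s = ψ c * y j) :
    (∑ m ∈ f.support, Polynomial.C (C (coeff m f)) *
        ((∏ i, Polynomial.C (X i) ^ m (Sum.inl i)) *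
          ((∏ j, N j ^ m (Sum.inr j)) * Polynomial.C c ^ (e - ∑ j, m (Sum.inr j))))).eval₂ ψ s =
      ψ c ^ e * f.eval₂ (ψ.comp C) (Sum.elim (fun i => ψ (X i)) y) := by
  set E : Polynomial (MvPolynomial (Fin n) ℂ) →+* S := Polynomial.eval₂RingHom ψ s with hE
  change E _ = _
  rw [MvPolynomial.eval₂_eq, Finset.mul_sum, map_sum]
  refine Finset.sum_congr rfl fun m hm => ?_
  have hEC : ∀ a, E (Polynomial.C a) = ψ a := fun a => by simp [hE]
  have hEN : ∀ j, E (N j) = ψ c * y j := fun j => by simpa [hE] using hy j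
  simp only [map_mul, map_prod, map_pow, hEC, hEN]
  -- the monomial `∏_{s ∈ m.support} v_s ^ m_s` as a product over all indices
  have hmon : (∏ k ∈ m.support, Sum.elim (fun i => ψ (X i)) y k ^ m k) =
      (∏ i, ψ (X i) ^ m (Sum.inl i)) * ∏ j, y j ^ m (Sum.inr j) := by
    have : (∏ k ∈ m.support, Sum.elim (fun i => ψ (X i)) y k ^ m k) =
        ∏ k, Sum.elim (fun i => ψ (X i)) y k ^ m k := by
      rw [← Finsupp.prod_fintype m (fun k r => Sum.elim (fun i => ψ (X i)) y k ^ r) (by simp)]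
      rfl
    rw [this, Fintype.prod_sum_type]
    simp
  rw [hmon, RingHom.comp_apply]
  have hsum := he m hm
  have hpow : ψ c ^ (e - ∑ j, m (Sum.inr j)) * ψ c ^ (∑ j, m (Sum.inr j)) = ψ c ^ e := by
    rw [← pow_add, Nat.sub_add_cancel hsum]
  simp only [mul_pow, Finset.prod_mul_distrib, Finset.prod_pow_eq_pow_sum]
  rw [← hpow]
  ring

set_option maxHeartbeats 1000000 in
/-- **The hypersurface model** (D'Aquino–Fornasiero–Terzo 2018, Cor. 2.9 / Lemma 2.10 made
explicit; Shafarevich VII §2.3, Lemma, in the generically finite case). Let `P ⊆ ℂ[x, y]`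
(`x, y` of length `n`) be a prime ideal with `dim ℂ[x, y]/P = n`, `P ∩ ℂ[x] = 0` (dominant
projection to the `x`-space) and `yⱼ ∉ P`. Then there are `F ∈ ℂ[x][T]` monic of positive
degree, `g ∈ ℂ[x]`, `g ≠ 0`, `N ∈ ℂ[x][T]ⁿ`, `c ∈ ℂ[x]` and `p ∈ ℂ[x][u]ⁿ` with `pⱼ(x, 0) ≠ 0`
such that, whenever `g(z) ≠ 0`: `F(z, ·)` is separable, `c(z) ≠ 0`, and for every root `t` of
`F(z, ·)` the point `(z, N(z, t)/c(z))` lies on `Z(P)`; and `pⱼ(x, yⱼ)` vanishes on `Z(P)`.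
[cite: DaquinoFornasieroTerzo2017, Cor. 2.9 and Lemma 2.10 (proof)] -/
theorem exists_model (P : Ideal (MvPolynomial (Fin n ⊕ Fin n) ℂ)) [P.IsPrime]
    (hdim : ringKrullDim (zeroLocusCoordRing P) = n)
    (hdom : ∀ p : MvPolynomial (Fin n) ℂ, rename Sum.inl p ∈ P → p = 0)
    (hY : ∀ j, (X (Sum.inr j) : MvPolynomial (Fin n ⊕ Fin n) ℂ) ∉ P) :
    ∃ (F : Polynomial (MvPolynomial (Fin n) ℂ)) (g : MvPolynomial (Fin n) ℂ)
      (N : Fin n → Polynomial (MvPolynomial (Fin n) ℂ)) (c : MvPolynomial (Fin n) ℂ)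
      (p : Fin n → Polynomial (MvPolynomial (Fin n) ℂ)),
      F.Monic ∧ 0 < F.natDegree ∧ g ≠ 0 ∧
      (∀ z, eval z g ≠ 0 → (spec F z).Separable) ∧
      (∀ z, eval z g ≠ 0 → eval z c ≠ 0) ∧
      (∀ z t, eval z g ≠ 0 → (spec F z).eval t = 0 →
        (Sum.elim z (fun j => (spec (N j) z).eval t / eval z c) : Fin n ⊕ Fin n → ℂ) ∈
          zeroLocus ℂ P) ∧
      (∀ j, (p j).coeff 0 ≠ 0) ∧
      (∀ j, ∀ w ∈ zeroLocus ℂ P,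
        (spec (p j) (fun i => w (Sum.inl i))).eval (w (Sum.inr j)) = 0) := by
  classical
  -- ### the coordinate ring `A = ℂ[x, y]/P`, the function field `L`, `ℂ[x] ↪ A ↪ L`
  set ξ : Fin n ⊕ Fin n → zeroLocusFunctionField P := genericPt P with hξ
  set φ : MvPolynomial (Fin n) ℂ →ₐ[ℂ] zeroLocusCoordRing P := (Ideal.Quotient.mkₐ ℂ P).comp (rename Sum.inl)
    with hφ
  have hφapply : ∀ q : MvPolynomial (Fin n) ℂ, φ q = Ideal.Quotient.mk P (rename Sum.inl q) := fun q => rfl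
  have hφinj : Function.Injective φ := by
    rw [injective_iff_map_eq_zero]
    intro q hq
    rw [hφapply, Ideal.Quotient.eq_zero_iff_mem] at hq
    exact hdom q hq
  letI instBA : Algebra (MvPolynomial (Fin n) ℂ) (zeroLocusCoordRing P) := φ.toRingHom.toAlgebra
  have halgBA : ∀ q : MvPolynomial (Fin n) ℂ, algebraMap (MvPolynomial (Fin n) ℂ) (zeroLocusCoordRing P) q = φ q := fun _ => rfl
  haveI : IsScalarTower ℂ (MvPolynomial (Fin n) ℂ) (zeroLocusCoordRing P) :=
    IsScalarTower.of_algebraMap_eq fun z => (φ.commutes z).symm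
  haveI : FaithfulSMul (MvPolynomial (Fin n) ℂ) (zeroLocusCoordRing P) :=
    (faithfulSMul_iff_algebraMap_injective (MvPolynomial (Fin n) ℂ) (zeroLocusCoordRing P)).mpr hφinj
  haveI : IsScalarTower (MvPolynomial (Fin n) ℂ) (zeroLocusCoordRing P) (zeroLocusFunctionField P) := inferInstance
  have halgBL : ∀ q : MvPolynomial (Fin n) ℂ, algebraMap (MvPolynomial (Fin n) ℂ) (zeroLocusFunctionField P) q =
      aeval (fun i => ξ (Sum.inl i)) q := by
    intro q
    rw [IsScalarTower.algebraMap_apply (MvPolynomial (Fin n) ℂ) (zeroLocusCoordRing P) (zeroLocusFunctionField P),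
      halgBA, hφapply, hξ, ← aeval_genericPt, aeval_rename]
    rfl
  have hBLinj : Function.Injective (algebraMap (MvPolynomial (Fin n) ℂ) (zeroLocusFunctionField P)) := by
    rw [IsScalarTower.algebraMap_eq (MvPolynomial (Fin n) ℂ) (zeroLocusCoordRing P) (zeroLocusFunctionField P)]
    exact (IsFractionRing.injective (zeroLocusCoordRing P) (zeroLocusFunctionField P)).comp hφinj
  haveI : FaithfulSMul (MvPolynomial (Fin n) ℂ) (zeroLocusFunctionField P) :=
    (faithfulSMul_iff_algebraMap_injective (MvPolynomial (Fin n) ℂ) (zeroLocusFunctionField P)).mpr hBLinj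
  letI : Algebra (FractionRing (MvPolynomial (Fin n) ℂ)) (zeroLocusFunctionField P) :=
    FractionRing.liftAlgebra (MvPolynomial (Fin n) ℂ) (zeroLocusFunctionField P)
  haveI : IsScalarTower (MvPolynomial (Fin n) ℂ) (FractionRing (MvPolynomial (Fin n) ℂ)) (zeroLocusFunctionField P) :=
    FractionRing.isScalarTower_liftAlgebra _ _
  -- ### `trdeg_ℂ L = n` and `x` is a transcendence basis, so `L / K` is algebraic
  have htrA : Algebra.trdeg ℂ (zeroLocusCoordRing P) = n := by
    obtain ⟨s, hs, ht⟩ :=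
      Literature.RingTheory.KrullDimension.exists_ringKrullDim_eq_and_trdeg_eq ℂ
        (zeroLocusCoordRing P)
    rw [hdim] at hs
    have hns : n = s := by exact_mod_cast hs
    rw [ht, hns]
  have htrL : Algebra.trdeg ℂ (zeroLocusFunctionField P) = n := by
    rw [trdeg_zeroLocusFunctionField_eq, htrA]
  set xL : Fin n → zeroLocusFunctionField P := fun i => ξ (Sum.inl i) with hxL
  have haevalxL : ∀ q : MvPolynomial (Fin n) ℂ, aeval xL q = algebraMap (MvPolynomial (Fin n) ℂ) (zeroLocusFunctionField P) q :=
    fun q => (halgBL q).symm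
  have hxLind : AlgebraicIndependent ℂ xL := by
    rw [algebraicIndependent_iff_injective_aeval]
    intro q q' hqq'
    apply hBLinj
    rwa [← haevalxL, ← haevalxL]
  have htb : IsTranscendenceBasis ℂ xL :=
    hxLind.isTranscendenceBasis_of_trdeg_le_of_finite (by rw [htrL]; simp)
  have halgL : Algebra.IsAlgebraic (Algebra.adjoin ℂ (Set.range xL)) (zeroLocusFunctionField P) :=
    htb.isAlgebraic
  haveI halgBxL : Algebra.IsAlgebraic (MvPolynomial (Fin n) ℂ) (zeroLocusFunctionField P) := by
    set φL : MvPolynomial (Fin n) ℂ →ₐ[ℂ] zeroLocusFunctionField P := aeval xL with hφL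
    have hrange : Algebra.adjoin ℂ (Set.range xL) = φL.range := by
      rw [Algebra.adjoin_range_eq_range_aeval]
    rw [hrange] at halgL
    refine Algebra.IsAlgebraic.of_ringHom_of_comp_eq (R := MvPolynomial (Fin n) ℂ) (A := zeroLocusFunctionField P)
      (S := φL.range) (B := zeroLocusFunctionField P) φL.rangeRestrict.toRingHom
      (RingHom.id _) (AlgHom.rangeRestrict_surjective φL) Function.injective_id ?_
    refine RingHom.ext fun q => ?_
    change (φL q : zeroLocusFunctionField P) = algebraMap (MvPolynomial (Fin n) ℂ) (zeroLocusFunctionField P) q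
    rw [hφL, haevalxL]
  haveI halgKL : Algebra.IsAlgebraic (FractionRing (MvPolynomial (Fin n) ℂ)) (zeroLocusFunctionField P) :=
    (IsFractionRing.comap_isAlgebraic_iff (A := MvPolynomial (Fin n) ℂ) (K := FractionRing (MvPolynomial (Fin n) ℂ))).mp halgBxL
  -- ### a primitive element of `K(y₁, …, yₙ)`, made integral over `ℂ[x]`
  set yL : Fin n → zeroLocusFunctionField P := fun j => ξ (Sum.inr j) with hyL
  have hyL0 : ∀ j, yL j ≠ 0 := fun j h => hY j ((aeval_genericPt_eq_zero_iff P _).mp (by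
    rw [aeval_X]; exact h))
  set M := IntermediateField.adjoin (FractionRing (MvPolynomial (Fin n) ℂ)) (Set.range yL) with hM
  have hintK : ∀ w : zeroLocusFunctionField P, IsIntegral (FractionRing (MvPolynomial (Fin n) ℂ)) w := fun w =>
    (Algebra.IsAlgebraic.isAlgebraic w).isIntegral
  haveI : FiniteDimensional (FractionRing (MvPolynomial (Fin n) ℂ)) M := IntermediateField.finiteDimensional_adjoin fun w _ => hintK w
  haveI : Algebra.IsSeparable (FractionRing (MvPolynomial (Fin n) ℂ)) M := inferInstance
  obtain ⟨α, hα⟩ := Field.exists_primitive_element (FractionRing (MvPolynomial (Fin n) ℂ)) M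
  -- each `yⱼ` is a `K`-polynomial in `α`
  have hyM : ∀ j, yL j ∈ M := fun j => IntermediateField.subset_adjoin _ _ ⟨j, rfl⟩
  have hex : ∀ j, ∃ gj : Polynomial (FractionRing (MvPolynomial (Fin n) ℂ)),
      yL j = Polynomial.aeval (α : zeroLocusFunctionField P) gj := by
    intro j
    have hmem : (⟨yL j, hyM j⟩ : M) ∈ IntermediateField.adjoin (FractionRing (MvPolynomial (Fin n) ℂ)) {α} := by
      rw [hα]; exact IntermediateField.mem_top
    rw [← IntermediateField.mem_toSubalgebra, IntermediateField.adjoin_simple_toSubalgebra_of_isAlgebraic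
      (Algebra.IsAlgebraic.isAlgebraic α), Algebra.adjoin_singleton_eq_range_aeval,
      AlgHom.mem_range] at hmem
    obtain ⟨gj, hgj⟩ := hmem
    refine ⟨gj, ?_⟩
    have h := congrArg (fun m : M => (m : zeroLocusFunctionField P)) hgj
    simp only at h
    rw [← h]
    exact (Polynomial.aeval_algHom_apply M.val α gj).symm
  -- an integral multiple `t = b α` of `α`
  have hαalgK : IsAlgebraic (FractionRing (MvPolynomial (Fin n) ℂ)) (α : zeroLocusFunctionField P) :=
    Algebra.IsAlgebraic.isAlgebraic _
  have hαalgB : IsAlgebraic (MvPolynomial (Fin n) ℂ) (α : zeroLocusFunctionField P) :=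
    (IsFractionRing.isAlgebraic_iff (MvPolynomial (Fin n) ℂ) (FractionRing (MvPolynomial (Fin n) ℂ)) (zeroLocusFunctionField P)).mpr hαalgK
  obtain ⟨b, hb0, hbint⟩ := hαalgB.exists_integral_multiple
  set t : zeroLocusFunctionField P := b • (α : zeroLocusFunctionField P) with ht
  have htint : IsIntegral (MvPolynomial (Fin n) ℂ) t := hbint
  have hbL : algebraMap (MvPolynomial (Fin n) ℂ) (zeroLocusFunctionField P) b ≠ 0 := (map_ne_zero_iff _ hBLinj).mpr hb0
  have htα : (α : zeroLocusFunctionField P) =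
      algebraMap (FractionRing (MvPolynomial (Fin n) ℂ)) _ ((algebraMap (MvPolynomial (Fin n) ℂ) (FractionRing (MvPolynomial (Fin n) ℂ)) b)⁻¹) * t := by
    rw [ht, Algebra.smul_def, map_inv₀, ← IsScalarTower.algebraMap_apply, ← mul_assoc,
      inv_mul_cancel₀ hbL, one_mul]
  have hex' : ∀ j, ∃ gj : Polynomial (FractionRing (MvPolynomial (Fin n) ℂ)), yL j = Polynomial.aeval t gj := by
    intro j
    obtain ⟨gj, hgj⟩ := hex j
    refine ⟨gj.comp (Polynomial.C ((algebraMap (MvPolynomial (Fin n) ℂ) (FractionRing (MvPolynomial (Fin n) ℂ)) b)⁻¹) * Polynomial.X), ?_⟩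
    rw [Polynomial.aeval_comp, map_mul, Polynomial.aeval_C, Polynomial.aeval_X, ← htα]
    exact hgj
  -- clear denominators, with a common denominator `c`
  have hex'' : ∀ j, ∃ Nj : Polynomial (MvPolynomial (Fin n) ℂ), ∃ dj : MvPolynomial (Fin n) ℂ, dj ≠ 0 ∧
      Polynomial.aeval t Nj = algebraMap (MvPolynomial (Fin n) ℂ) _ dj * yL j := by
    intro j
    obtain ⟨gj, hgj⟩ := hex' j
    obtain ⟨dj, hdj, hdg⟩ := IsLocalization.integerNormalization_spec (nonZeroDivisors (MvPolynomial (Fin n) ℂ)) gj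
    refine ⟨IsLocalization.integerNormalization (nonZeroDivisors (MvPolynomial (Fin n) ℂ)) gj, dj,
      nonZeroDivisors.ne_zero hdj, ?_⟩
    rw [← Polynomial.aeval_map_algebraMap (FractionRing (MvPolynomial (Fin n) ℂ)), hdg, ← algebraMap_smul (FractionRing (MvPolynomial (Fin n) ℂ)) dj gj, map_smul,
      ← hgj, IsScalarTower.algebraMap_apply (MvPolynomial (Fin n) ℂ) (FractionRing (MvPolynomial (Fin n) ℂ)) (zeroLocusFunctionField P),
      Algebra.smul_def]
  choose N₀ d₀ hd₀ hN₀ using hex''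
  set c : MvPolynomial (Fin n) ℂ := ∏ j, d₀ j with hc
  have hc0 : c ≠ 0 := Finset.prod_ne_zero_iff.mpr fun j _ => hd₀ j
  set N : Fin n → Polynomial (MvPolynomial (Fin n) ℂ) := fun j =>
    Polynomial.C (∏ j' ∈ Finset.univ.erase j, d₀ j') * N₀ j with hN
  have hNt : ∀ j, Polynomial.aeval t (N j) = algebraMap (MvPolynomial (Fin n) ℂ) _ c * yL j := by
    intro j
    simp only [hN, map_mul, Polynomial.aeval_C, hN₀]
    rw [← mul_assoc, ← map_mul, Finset.prod_erase_mul _ _ (Finset.mem_univ j)]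
  -- ### the minimal polynomial `F` of `t` and its generic separability
  set F := minpoly (MvPolynomial (Fin n) ℂ) t with hF
  have hFmonic : F.Monic := minpoly.monic htint
  have hFdeg : 0 < F.natDegree := minpoly.natDegree_pos htint
  obtain ⟨dsep, hdsep0, hdsep⟩ : ∃ d : MvPolynomial (Fin n) ℂ, d ≠ 0 ∧
      ∀ z : Fin n → ℂ, eval z d ≠ 0 → (spec F z).Separable := by
    have hFK : F.map (algebraMap _ (FractionRing (MvPolynomial (Fin n) ℂ))) = minpoly (FractionRing (MvPolynomial (Fin n) ℂ)) t :=
      (minpoly.isIntegrallyClosed_eq_field_fractions' (FractionRing (MvPolynomial (Fin n) ℂ)) htint).symm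
    have htK : IsIntegral (FractionRing (MvPolynomial (Fin n) ℂ)) t := htint.tower_top
    have hirr : Irreducible (F.map (algebraMap _ (FractionRing (MvPolynomial (Fin n) ℂ)))) := hFK ▸ minpoly.irreducible htK
    have hsepK : (F.map (algebraMap _ (FractionRing (MvPolynomial (Fin n) ℂ)))).Separable := PerfectField.separable_of_irreducible hirr
    obtain ⟨u, v, huv⟩ := hsepK
    rw [Polynomial.derivative_map] at huv
    obtain ⟨du, hdu, hu⟩ :=
      IsLocalization.integerNormalization_spec (nonZeroDivisors (MvPolynomial (Fin n) ℂ)) u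
    obtain ⟨dv, hdv, hv⟩ :=
      IsLocalization.integerNormalization_spec (nonZeroDivisors (MvPolynomial (Fin n) ℂ)) v
    set U := IsLocalization.integerNormalization (nonZeroDivisors (MvPolynomial (Fin n) ℂ)) u
    set V := IsLocalization.integerNormalization (nonZeroDivisors (MvPolynomial (Fin n) ℂ)) v
    have hid : Polynomial.C dv * U * F + Polynomial.C du * V * Polynomial.derivative F =
        Polynomial.C (du * dv) := by
      apply Polynomial.map_injective (algebraMap _ (FractionRing (MvPolynomial (Fin n) ℂ))) (IsFractionRing.injective _ _)
      simp only [Polynomial.map_add, Polynomial.map_mul, Polynomial.map_C, hu, hv]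
      rw [← algebraMap_smul (FractionRing (MvPolynomial (Fin n) ℂ)) du u, ← algebraMap_smul (FractionRing (MvPolynomial (Fin n) ℂ)) dv v, Polynomial.smul_eq_C_mul,
        Polynomial.smul_eq_C_mul, map_mul, Polynomial.C_mul]
      linear_combination
        (Polynomial.C (algebraMap _ (FractionRing (MvPolynomial (Fin n) ℂ)) du) * Polynomial.C (algebraMap _ (FractionRing (MvPolynomial (Fin n) ℂ)) dv)) * huv
    refine ⟨du * dv, mul_ne_zero (nonZeroDivisors.ne_zero hdu) (nonZeroDivisors.ne_zero hdv),
      fun z hz => ?_⟩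
    have hz' := congrArg (Polynomial.map (MvPolynomial.eval z)) hid
    simp only [Polynomial.map_add, Polynomial.map_mul, Polynomial.map_C,
      ← Polynomial.derivative_map] at hz'
    rw [Polynomial.separable_def]
    refine ⟨Polynomial.C (MvPolynomial.eval z (du * dv))⁻¹ *
        (Polynomial.C (MvPolynomial.eval z dv) * U.map (MvPolynomial.eval z)),
      Polynomial.C (MvPolynomial.eval z (du * dv))⁻¹ *
        (Polynomial.C (MvPolynomial.eval z du) * V.map (MvPolynomial.eval z)), ?_⟩
    have hC : Polynomial.C (MvPolynomial.eval z (du * dv))⁻¹ *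
        Polynomial.C (MvPolynomial.eval z (du * dv)) = (1 : Polynomial ℂ) := by
      rw [← Polynomial.C_mul, inv_mul_cancel₀ hz, Polynomial.C_1]
    linear_combination (Polynomial.C (MvPolynomial.eval z (du * dv))⁻¹) * hz' + hC
  -- ### points of `Z(P)` from roots of `F(z, ·)`
  have hmem : ∀ (z : Fin n → ℂ) (τ : ℂ), eval z c ≠ 0 → (spec F z).eval τ = 0 →
      (Sum.elim z (fun j => (spec (N j) z).eval τ / eval z c) : Fin n ⊕ Fin n → ℂ) ∈
        zeroLocus ℂ P := by
    intro z τ hcz hFτ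
    rw [MvPolynomial.mem_zeroLocus_iff]
    intro f hf
    change eval _ f = 0
    set e := f.totalDegree with he
    have hesupp : ∀ m ∈ f.support, ∑ j, m (Sum.inr j) ≤ e := by
      intro m hm
      refine le_trans ?_ (le_totalDegree hm)
      rw [show (m.sum fun _ k => k) = ∑ s, m s from m.sum_fintype _ (by simp),
        Fintype.sum_sum_type]
      simp
    set Ff : Polynomial (MvPolynomial (Fin n) ℂ) := ∑ m ∈ f.support, Polynomial.C (C (coeff m f)) *
        ((∏ i, Polynomial.C (X i) ^ m (Sum.inl i)) *
          ((∏ j, N j ^ m (Sum.inr j)) * Polynomial.C c ^ (e - ∑ j, m (Sum.inr j)))) with hFf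
    -- `Ff(t) = c^e · f(ξ) = 0` in `L`, so `F ∣ Ff`
    have hFft : Polynomial.aeval t Ff = 0 := by
      have key := eval₂_clearedPoly f N c e hesupp (algebraMap (MvPolynomial (Fin n) ℂ) (zeroLocusFunctionField P))
        t yL (fun j => by rw [← Polynomial.aeval_def]; exact hNt j)
      rw [Polynomial.aeval_def, hFf, key]
      have h1 : (algebraMap (MvPolynomial (Fin n) ℂ) (zeroLocusFunctionField P)).comp C = algebraMap ℂ _ := by
        refine RingHom.ext fun a => ?_
        rw [RingHom.comp_apply, halgBL, algHom_C]
      have h2 : (Sum.elim (fun i => algebraMap (MvPolynomial (Fin n) ℂ) (zeroLocusFunctionField P) (X i)) yL) = ξ := by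
        funext s
        rcases s with i | j
        · simp only [Sum.elim_inl]
          rw [halgBL, aeval_X]
        · rfl
      rw [h1, h2, ← MvPolynomial.aeval_def, (aeval_genericPt_eq_zero_iff P f).mpr hf, mul_zero]
    obtain ⟨G, hG⟩ := minpoly.isIntegrallyClosed_dvd htint hFft
    -- evaluate `Ff = F G` at `(z, τ)`
    set y : Fin n → ℂ := fun j => (spec (N j) z).eval τ / eval z c with hy
    have key2 := eval₂_clearedPoly f N c e hesupp (eval z) τ y (fun j => by
      simp only [hy]
      rw [mul_div_cancel₀ _ hcz, ← Polynomial.eval_map])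
    have hzero : Ff.eval₂ (eval z) τ = 0 := by
      rw [hG, Polynomial.eval₂_mul]
      have : F.eval₂ (eval z) τ = 0 := by rwa [← Polynomial.eval_map]
      rw [this, zero_mul]
    rw [hFf] at hzero
    rw [hzero] at key2
    have hce : eval z c ^ e ≠ 0 := pow_ne_zero _ hcz
    have h3 : f.eval₂ ((eval z).comp C) (Sum.elim (fun i => eval z (X i)) y) =
        eval (Sum.elim z y) f := by
      have h1 : (eval z).comp (C : ℂ →+* MvPolynomial (Fin n) ℂ) = RingHom.id ℂ := by
        refine RingHom.ext fun a => ?_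
        simp
      have h2 : (Sum.elim (fun i => eval z (X i)) y) = Sum.elim z y := by
        funext s
        rcases s with i | j <;> simp
      rw [h1, h2]
      rfl
    rw [h3] at key2
    exact (mul_eq_zero.mp key2.symm).resolve_left hce
  -- ### relations `pⱼ(x, yⱼ) = 0` with `pⱼ(x, 0) ≠ 0`
  have hrel : ∀ j, ∃ pj : Polynomial (MvPolynomial (Fin n) ℂ), pj.coeff 0 ≠ 0 ∧ ∀ w ∈ zeroLocus ℂ P,
      (spec pj (fun i => w (Sum.inl i))).eval (w (Sum.inr j)) = 0 := by
    intro j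
    obtain ⟨q, hq0, hqy⟩ := (Algebra.IsAlgebraic.isAlgebraic (yL j) : IsAlgebraic (MvPolynomial (Fin n) ℂ) (yL j))
    obtain ⟨q', hq', hndvd⟩ := Polynomial.exists_eq_pow_rootMultiplicity_mul_and_not_dvd q hq0 0
    have hq'0 : q'.coeff 0 ≠ 0 := by
      rwa [map_zero, sub_zero, Polynomial.X_dvd_iff] at hndvd
    have hq'y : Polynomial.aeval (yL j) q' = 0 := by
      rw [hq', map_mul, map_pow, map_sub, Polynomial.aeval_X, Polynomial.aeval_C, map_zero,
        sub_zero] at hqy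
      exact (mul_eq_zero.mp hqy).resolve_left (pow_ne_zero _ (hyL0 j))
    have hQP : (∑ k ∈ Finset.range (q'.natDegree + 1),
        rename Sum.inl (q'.coeff k) * X (Sum.inr j) ^ k : MvPolynomial (Fin n ⊕ Fin n) ℂ) ∈ P := by
      rw [← aeval_genericPt_eq_zero_iff P, map_sum]
      have hk : ∀ k : ℕ, aeval (genericPt P) (rename Sum.inl (q'.coeff k) * X (Sum.inr j) ^ k :
          MvPolynomial (Fin n ⊕ Fin n) ℂ) =
          algebraMap (MvPolynomial (Fin n) ℂ) (zeroLocusFunctionField P) (q'.coeff k) * yL j ^ k := fun k => by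
        rw [map_mul, map_pow, aeval_X, aeval_rename, halgBL]
        rfl
      have hsum : (∑ k ∈ Finset.range (q'.natDegree + 1),
          algebraMap (MvPolynomial (Fin n) ℂ) (zeroLocusFunctionField P) (q'.coeff k) * yL j ^ k) =
          Polynomial.aeval (yL j) q' := by
        rw [Polynomial.aeval_def, Polynomial.eval₂_eq_sum_range]
      rw [Finset.sum_congr rfl fun k _ => hk k, hsum]
      exact hq'y
    refine ⟨q', hq'0, fun w hw => ?_⟩
    have hwQ := (MvPolynomial.mem_zeroLocus_iff.mp hw) _ hQP
    rw [MvPolynomial.aeval_eq_eval, map_sum] at hwQ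
    have hk : ∀ k : ℕ, eval w (rename Sum.inl (q'.coeff k) * X (Sum.inr j) ^ k :
        MvPolynomial (Fin n ⊕ Fin n) ℂ) =
        eval (fun i => w (Sum.inl i)) (q'.coeff k) * w (Sum.inr j) ^ k := fun k => by
      rw [map_mul, map_pow, eval_X, eval_rename]
      rfl
    have hsum : (∑ k ∈ Finset.range (q'.natDegree + 1),
        eval (fun i => w (Sum.inl i)) (q'.coeff k) * w (Sum.inr j) ^ k) =
        (spec q' (fun i => w (Sum.inl i))).eval (w (Sum.inr j)) := by
      rw [Polynomial.eval_map, Polynomial.eval₂_eq_sum_range]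
    rwa [Finset.sum_congr rfl fun k _ => hk k, hsum] at hwQ
  choose p hp0 hprel using hrel
  refine ⟨F, dsep * c, N, c, p, hFmonic, hFdeg, mul_ne_zero hdsep0 hc0, ?_, ?_, ?_, hp0, hprel⟩
  · intro z hz
    rw [map_mul] at hz
    exact hdsep z (left_ne_zero_of_mul hz)
  · intro z hz
    rw [map_mul] at hz
    exact right_ne_zero_of_mul hz
  · intro z τ hz hFz
    rw [map_mul] at hz
    exact hmem z τ (right_ne_zero_of_mul hz) hFz
end Literature.NumberTheory.Transcendental.ExpDominant
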